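import Summits.FinalStateConjecture.FinalStateConjecture.Theorems.EIHFluxBalanceInertialRecessionStubHigherOrderSliceJets
import Summits.FinalStateConjecture.FinalStateConjecture.Theorems.EIHFluxBalanceInertialRecessionAnsatzSmooth

/-!
# Route EIHFluxBalance — `InertialRecession` (E′), line `SketchCleanExcision`, skeleton r13,
# stub `stub_higherOrderSlaving` (EF): the modulated ansatz as a two-variable field

Helper file for the crux `stmt-FinalStateConjecture-17403`
(`Summit.FinalStateConjecture.FinalStateConjecture.Theses.EIHFluxBalance.InertialRecession`, E′),
registered stub `stub_higherOrderSlaving` (orders two and three of frozen-vacuum slaving).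

The frozen ansatz of the crux, `g₀(z) = η + Σᵢ (boostedKerrBilin (Λᵢ(z⁰)) (z⁰, ξᵢ(z⁰)) Mᵢ aᵢ z − η)`, is
the graph restriction `z ↦ Φ(z⁰, z)` of the TWO-VARIABLE field
`Φ(s, z) = η + Σᵢ (boostedKerrBilin (Λᵢ s) (s, ξᵢ s) Mᵢ aᵢ z − η)` (moduli frozen at lab time `s`):

* `higherOrder_ansatz_eq_graph` — the identity `g₀ = Φ ∘ (dx⁰, id)` (definitional);
* `higherOrder_contDiffAt_summand_twoVar`, `higherOrder_contDiffOn_ansatzField` — `Φ` is `C^∞` on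
  the open set where all painted radii are positive;
* `higherOrder_iteratedDeriv_fun_sum` — iterated `s`-derivatives of a finite sum of `Cⁿ` summands;

so that the `3`-jet of `g₀` at a slice point is given by `higherOrder_sliceJets`
(`…StubHigherOrderSliceJets`) in terms of the frozen field `Φ(t, ·)` and the variation fields
`∂ₛᵏΦ(t, ·)`, `k ≤ 3`, which are sums over the holes.

No definitions, no named facts, no `sorry`.
-/

set_option linter.dupNamespace false
set_option maxSynthPendingDepth 6
set_option synthInstance.maxHeartbeats 200000

noncomputable section

namespace Summit.FinalStateConjecture.FinalStateConjecture.Theorems.SublinearIsFree.Slaving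

open scoped Topology ContDiff BigOperators
open Filter Set Function Literature.Geometry.Lorentzian
  Summit.FinalStateConjecture.FinalStateConjecture.Theorems

/-- **The frozen ansatz is the graph restriction of the two-variable field** (definitional).
[folklore] -/
theorem higherOrder_ansatz_eq_graph (N : ℕ) (M a : Fin N → ℝ) (Λ : Fin N → ℝ → lorentzGroup)
    (ξ : Fin N → ℝ → E3) :
    (fun z : E4 ↦ Minkowski.bilin + ∑ i, (boostedKerrBilin (Λ i (z 0)) (E4.ofTimeSpace (z 0) (ξ i (z 0)))
      (M i) (a i) z - Minkowski.bilin)) =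
    fun z : E4 ↦ (fun q : ℝ × E4 ↦ Minkowski.bilin + ∑ i, (boostedKerrBilin (Λ i q.1)
      (E4.ofTimeSpace q.1 (ξ i q.1)) (M i) (a i) q.2 - Minkowski.bilin))
      ((EuclideanSpace.proj (0 : Fin 4) : E4 →L[ℝ] ℝ) z, z) := rfl

/-- **One modulated summand is smooth in (frozen time, point) where its painted radius is positive.**
[folklore] -/
theorem higherOrder_contDiffAt_summand_twoVar {Λ : ℝ → lorentzGroup} {ξ : ℝ → E3} (M a : ℝ)
    (hΛ : ContDiff ℝ ∞ (fun t ↦ ((Λ t : E4 ≃L[ℝ] E4) : E4 →L[ℝ] E4))) (hξ : ContDiff ℝ ∞ ξ)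
    {q : ℝ × E4} (hq : 0 < Kerr.radius a (poincareInv (Λ q.1) (E4.ofTimeSpace q.1 (ξ q.1)) q.2)) :
    ContDiffAt ℝ ∞ (fun q : ℝ × E4 ↦ boostedKerrBilin (Λ q.1) (E4.ofTimeSpace q.1 (ξ q.1)) M a q.2) q := by
  have h1 : ContDiff ℝ ∞ (fun q : ℝ × E4 ↦ q.1) := contDiff_fst
  have hA : ContDiff ℝ ∞ (fun q : ℝ × E4 ↦ (((Λ q.1 : E4 ≃L[ℝ] E4).symm : E4 ≃L[ℝ] E4) : E4 →L[ℝ] E4)) :=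
    (contDiff_lorentz_symm hΛ).comp h1
  have hc : ContDiff ℝ ∞ (fun q : ℝ × E4 ↦ E4.ofTimeSpace q.1 (ξ q.1)) := by
    have e : (fun q : ℝ × E4 ↦ E4.ofTimeSpace q.1 (ξ q.1)) =
        fun q ↦ q.1 • E4.basisVector 0 + E4.spaceEmbed (ξ q.1) := funext fun q ↦ E4.ofTimeSpace_eq_smul_add' _ _
    rw [e]; exact (h1.smul contDiff_const).add (E4.spaceEmbed.contDiff.comp (hξ.comp h1))
  have hP : ContDiff ℝ ∞ (fun q : ℝ × E4 ↦ poincareInv (Λ q.1) (E4.ofTimeSpace q.1 (ξ q.1)) q.2) := by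
    show ContDiff ℝ ∞ (fun q : ℝ × E4 ↦ ((Λ q.1 : E4 ≃L[ℝ] E4).symm) (q.2 - E4.ofTimeSpace q.1 (ξ q.1)))
    exact hA.clm_apply (contDiff_snd.sub hc)
  have hK : ContDiffAt ℝ ∞ (fun q : ℝ × E4 ↦ Kerr.bilin M a
      (poincareInv (Λ q.1) (E4.ofTimeSpace q.1 (ξ q.1)) q.2)) q :=
    ContDiffAt.comp (f := fun q : ℝ × E4 ↦ poincareInv (Λ q.1) (E4.ofTimeSpace q.1 (ξ q.1)) q.2)
      q (Kerr.contDiffAt_bilin M a hq) hP.contDiffAt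
  have hB := contDiffWithinAt_bilinearComp_self (s := Set.univ) hK.contDiffWithinAt
    hA.contDiffAt.contDiffWithinAt
  rw [contDiffWithinAt_univ] at hB
  refine hB.congr_of_eventuallyEq (Filter.Eventually.of_forall fun p ↦ ?_)
  show boostedKerrBilin (Λ p.1) (E4.ofTimeSpace p.1 (ξ p.1)) M a p.2 =
    (Kerr.bilin M a (poincareInv (Λ p.1) (E4.ofTimeSpace p.1 (ξ p.1)) p.2)).bilinearComp
      (((Λ p.1 : E4 ≃L[ℝ] E4).symm : E4 ≃L[ℝ] E4) : E4 →L[ℝ] E4)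
      (((Λ p.1 : E4 ≃L[ℝ] E4).symm : E4 ≃L[ℝ] E4) : E4 →L[ℝ] E4)
  rw [bilinearComp_self_eq_comp]
  rfl

/-- **The two-variable ansatz field is smooth on the open set where all painted radii are positive.**
[folklore] -/
theorem higherOrder_contDiffOn_ansatzField (N : ℕ) (M a : Fin N → ℝ) (Λ : Fin N → ℝ → lorentzGroup)
    (ξ : Fin N → ℝ → E3)
    (hΛ : ∀ i, ContDiff ℝ ∞ (fun t ↦ ((Λ i t : E4 ≃L[ℝ] E4) : E4 →L[ℝ] E4))) (hξ : ∀ i, ContDiff ℝ ∞ (ξ i)) :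
    IsOpen {q : ℝ × E4 | ∀ i, 0 < Kerr.radius (a i) (poincareInv (Λ i q.1) (E4.ofTimeSpace q.1 (ξ i q.1)) q.2)} ∧
    ContDiffOn ℝ ∞ (fun q : ℝ × E4 ↦ Minkowski.bilin + ∑ i, (boostedKerrBilin (Λ i q.1)
      (E4.ofTimeSpace q.1 (ξ i q.1)) (M i) (a i) q.2 - Minkowski.bilin))
      {q : ℝ × E4 | ∀ i, 0 < Kerr.radius (a i) (poincareInv (Λ i q.1) (E4.ofTimeSpace q.1 (ξ i q.1)) q.2)} := by
  have hcont : ∀ i, Continuous fun q : ℝ × E4 ↦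
      Kerr.radius (a i) (poincareInv (Λ i q.1) (E4.ofTimeSpace q.1 (ξ i q.1)) q.2) := by
    intro i
    have h1 : ContDiff ℝ ∞ (fun q : ℝ × E4 ↦ q.1) := contDiff_fst
    have hA : ContDiff ℝ ∞ (fun q : ℝ × E4 ↦ (((Λ i q.1 : E4 ≃L[ℝ] E4).symm : E4 ≃L[ℝ] E4) : E4 →L[ℝ] E4)) :=
      (contDiff_lorentz_symm (hΛ i)).comp h1
    have hc : ContDiff ℝ ∞ (fun q : ℝ × E4 ↦ E4.ofTimeSpace q.1 (ξ i q.1)) := by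
      have e : (fun q : ℝ × E4 ↦ E4.ofTimeSpace q.1 (ξ i q.1)) =
          fun q ↦ q.1 • E4.basisVector 0 + E4.spaceEmbed (ξ i q.1) := funext fun q ↦ E4.ofTimeSpace_eq_smul_add' _ _
      rw [e]; exact (h1.smul contDiff_const).add (E4.spaceEmbed.contDiff.comp ((hξ i).comp h1))
    have hP : ContDiff ℝ ∞ (fun q : ℝ × E4 ↦ poincareInv (Λ i q.1) (E4.ofTimeSpace q.1 (ξ i q.1)) q.2) := by
      show ContDiff ℝ ∞ (fun q : ℝ × E4 ↦ ((Λ i q.1 : E4 ≃L[ℝ] E4).symm) (q.2 - E4.ofTimeSpace q.1 (ξ i q.1)))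
      exact hA.clm_apply (contDiff_snd.sub hc)
    have h := (Kerr.continuous_radius (a i)).comp hP.continuous
    exact h
  have hopen : IsOpen {q : ℝ × E4 | ∀ i, 0 < Kerr.radius (a i) (poincareInv (Λ i q.1) (E4.ofTimeSpace q.1 (ξ i q.1)) q.2)} := by
    rw [show {q : ℝ × E4 | ∀ i, 0 < Kerr.radius (a i) (poincareInv (Λ i q.1) (E4.ofTimeSpace q.1 (ξ i q.1)) q.2)} =
      ⋂ i, {q : ℝ × E4 | 0 < Kerr.radius (a i) (poincareInv (Λ i q.1) (E4.ofTimeSpace q.1 (ξ i q.1)) q.2)} by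
      ext q; simp]
    exact isOpen_iInter_of_finite fun i ↦ isOpen_lt continuous_const (hcont i)
  refine ⟨hopen, fun q hq ↦ ?_⟩
  refine (contDiffAt_const.add (ContDiffAt.sum (s := Finset.univ) fun i _ ↦
    (higherOrder_contDiffAt_summand_twoVar (M i) (a i) (hΛ i) (hξ i) (hq i)).sub contDiffAt_const)).contDiffWithinAt

/-- **Iterated derivatives of a finite sum of `Cⁿ` functions of one variable.** [folklore] -/
theorem higherOrder_iteratedDeriv_fun_sum {F : Type*} [NormedAddCommGroup F] [NormedSpace ℝ F]
    {ι : Type*} {u : Finset ι} {f : ι → ℝ → F} {n : ℕ} {x : ℝ}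
    (h : ∀ j ∈ u, ContDiffAt ℝ n (f j) x) :
    iteratedDeriv n (fun s ↦ ∑ j ∈ u, f j s) x = ∑ j ∈ u, iteratedDeriv n (f j) x := by
  rw [iteratedDeriv_eq_iteratedFDeriv, iteratedFDeriv_fun_sum_apply h, _root_.sum_apply]
  simp only [iteratedDeriv_eq_iteratedFDeriv]

/-- **Iterated `s`-derivatives of the two-variable ansatz field**: at a frozen time `t` and a point
`z` with all painted radii positive, for `m ≥ 1`,
`∂ₛᵐ Φ(·, z)(t) = Σᵢ ∂ₛᵐ [s ↦ boostedKerrBilin (Λᵢ s) (s, ξᵢ s) Mᵢ aᵢ z](t)`. [folklore] -/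
theorem higherOrder_iteratedDeriv_ansatzField (N : ℕ) (M a : Fin N → ℝ) (Λ : Fin N → ℝ → lorentzGroup)
    (ξ : Fin N → ℝ → E3)
    (hΛ : ∀ i, ContDiff ℝ ∞ (fun t ↦ ((Λ i t : E4 ≃L[ℝ] E4) : E4 →L[ℝ] E4))) (hξ : ∀ i, ContDiff ℝ ∞ (ξ i))
    {t : ℝ} {z : E4} (hz : ∀ i, 0 < Kerr.radius (a i) (poincareInv (Λ i t) (E4.ofTimeSpace t (ξ i t)) z))
    {m : ℕ} (hm : 0 < m) :
    iteratedDeriv m (fun s ↦ (fun q : ℝ × E4 ↦ Minkowski.bilin + ∑ i, (boostedKerrBilin (Λ i q.1)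
      (E4.ofTimeSpace q.1 (ξ i q.1)) (M i) (a i) q.2 - Minkowski.bilin)) (s, z)) t =
    ∑ i, iteratedDeriv m (fun s ↦ boostedKerrBilin (Λ i s) (E4.ofTimeSpace s (ξ i s)) (M i) (a i) z) t := by
  have hsm : ∀ i, ContDiffAt ℝ m (fun s ↦ boostedKerrBilin (Λ i s) (E4.ofTimeSpace s (ξ i s)) (M i) (a i) z) t :=
    fun i ↦ ((higherOrder_contDiffAt_summand_twoVar (M i) (a i) (hΛ i) (hξ i) (q := (t, z)) (hz i)).comp t
      (contDiff_prodMk_left z).contDiffAt).of_le (by exact_mod_cast le_top)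
  show iteratedDeriv m (fun s ↦ Minkowski.bilin + ∑ i, (boostedKerrBilin (Λ i s)
      (E4.ofTimeSpace s (ξ i s)) (M i) (a i) z - Minkowski.bilin)) t = _
  rw [iteratedDeriv_const_add hm, higherOrder_iteratedDeriv_fun_sum fun i _ ↦ (hsm i).sub contDiffAt_const]
  refine Finset.sum_congr rfl fun i _ ↦ ?_
  rw [show (fun s ↦ boostedKerrBilin (Λ i s) (E4.ofTimeSpace s (ξ i s)) (M i) (a i) z - Minkowski.bilin) =
    fun s ↦ (-Minkowski.bilin) + boostedKerrBilin (Λ i s) (E4.ofTimeSpace s (ξ i s)) (M i) (a i) z by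
    funext s; rw [sub_eq_add_neg, add_comm]]
  exact iteratedDeriv_const_add hm _

/-- **Registered one-line carrier form** (`higherOrder_ansatzField_EF`) of
`higherOrder_iteratedDeriv_ansatzField`. [folklore] -/
theorem higherOrder_ansatzField_EF : open Literature.Geometry.Lorentzian in ∀ (N : ℕ) (M a : Fin N → ℝ) (Λ : Fin N → ℝ → lorentzGroup) (ξ : Fin N → ℝ → E3), (∀ i, ContDiff ℝ ((⊤ : ℕ∞) : WithTop ℕ∞) (fun t ↦ ((Λ i t : E4 ≃L[ℝ] E4) : E4 →L[ℝ] E4))) → (∀ i, ContDiff ℝ ((⊤ : ℕ∞) : WithTop ℕ∞) (ξ i)) → ∀ {t : ℝ} {z : E4}, (∀ i, 0 < Kerr.radius (a i) (poincareInv (Λ i t) (E4.ofTimeSpace t (ξ i t)) z)) → ∀ {m : ℕ}, 0 < m → iteratedDeriv m (fun s ↦ (fun q : ℝ × E4 ↦ Minkowski.bilin + ∑ i, (boostedKerrBilin (Λ i q.1) (E4.ofTimeSpace q.1 (ξ i q.1)) (M i) (a i) q.2 - Minkowski.bilin)) (s, z)) t = ∑ i, iteratedDeriv m (fun s ↦ boostedKerrBilin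 (Λ i s) (E4.ofTimeSpace s (ξ i s)) (M i) (a i) z) t :=
  fun N M a Λ ξ hΛ hξ _ _ hz _ hm ↦ higherOrder_iteratedDeriv_ansatzField N M a Λ ξ hΛ hξ hz hm

end Summit.FinalStateConjecture.FinalStateConjecture.Theorems.SublinearIsFree.Slaving

end
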